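import Mathlib
import Summits.QuantumFields.YangMills.Theorems.FemtoTransferGapMultiplierIMS
import Summits.QuantumFields.YangMills.Theorems.LuscherReductionRunningReductionLatticeTopLower
import Summits.QuantumFields.YangMills.Theorems.LuscherReductionRunningReductionCoarseUpperCopies
import HarnessLib

/-!
# Preliminaries for `AdjointLoopFano.AdjointLoopDirichlet` (item stmt-QuantumFields-23322): the exact vacuum Dirichlet identity
# and the mean temporal plaquette in the vacuum pair measure

Route `AdjointLoopFano` (D-0145 LINE g16-B of seat ym-idea-4, rev 1; critic PASS tier B).  Steps (i) and (iii)–(iv) of the planner's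
stub plan `B2-plan.md` for the kinematic crux B2, typed over the tree's femto currency (no new carrier, no new definition):

* §1 `deficit_eq_half_integral_sq` — for a normalised physical exact ground state `Ω` (`K_βΩ = λ₀Ω`) and a bounded invariant multiplier
  `g`: `λ₀‖gΩ‖² − ⟨gΩ, K_β(gΩ)⟩ = ½ ∫∫ Ω(U) K_β(U,V) Ω(V) (g(U) − g(V))²` (the tree's product identity `energy_mul_eq_su2` at `s = λ₀`,
  where the first bracket vanishes by the eigen-equation).
* §2 `integral_mul_le_mul_log` — the elementary Jensen step `∫ X w ≤ (∫w) · log(∫ e^X w / ∫ w)` for a non-negative weight (tangent line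
  of `exp`; no convexity library).
* §3 `vacuum_mean_temporal_plaquette_le` — in the vacuum PAIR measure `Ω(U)K_β(U,V)Ω(V) dU dV` (total mass `λ₀`) the summed temporal
  plaquette `Σₑ (2 − Re tr UₑVₑ⁻¹) = 2|E| − timeCoupling` has mean `≤ (2/β)·λ₀·Γ(β,L)`, `Γ = O(|E| log β)` EXPLICIT: Jensen with
  `X = (β/2)(2|E| − timeCoupling)`, `K_β e^X ≤ e^{β|E|} E_{β/2}` (drop the magnetic factor), the row sums `∫E_{β/2} = c_{β/2}^{|E|}`,
  and the tree's two-sided free-energy bounds `levelValue_zero_ge_poly` (`λ₀ ≥ poly(β)^{−2|E|} e^{−(8|P|+2|E|)} c_β^{|E|}`), `linkC_le`,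
  `linkC_ge_poly` — the `β|E|` terms cancel exactly.

HONEST FRAMING: kinematic bookkeeping; the crux `AdjointLoopDirichlet` (the F-WEIGHTED plaquette mean and the second-order remainder) is
OPEN; K2a, R2ξ″ and every summit statement remain OPEN; the YM mass gap is NOT proved.  No `sorry`, no new axiom, no new definition.
References: [cite: ReedSimonIV1978, Thm. XIII.1]; [cite: SimonB1983DiscreteSpectrum, §3]; [cite: Luscher1983, §3].
-/

set_option autoImplicit false

noncomputable section

open MeasureTheory Filter Topology Real
open Literature.MathematicalPhysics.QuantumFieldTheory (GaugeConfig Site Edge Plaquette gaugeTransform wilsonAction)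
open Literature.MathematicalPhysics.QuantumLattice (fundamentalRep_apply secondCountableTopology_su2)

namespace Summit.QuantumFields.YangMills.Theorems.AdjointLoopFano

open Summit.QuantumFields.YangMills.Theorems.FemtoTransferGap

variable {L : ℕ} [NeZero L]

/-! ## §1 The exact vacuum Dirichlet identity -/

/-- ★ **Ground-state Dirichlet identity.**  For a physical `Ω` with `K_βΩ = λ₀Ω` and a bounded measurable gauge- and twist-invariant
multiplier `g`: `λ₀‖gΩ‖² − ⟨gΩ, K_β(gΩ)⟩ = ½ ∫∫ Ω(U)K_β(U,V)Ω(V)(g(U) − g(V))²`. [cite: SimonB1983DiscreteSpectrum, §3] -/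
theorem deficit_eq_half_integral_sq (β : ℝ) {g : GaugeConfig 3 L SU2 → ℝ} (hgm : Measurable g) {Cg : ℝ}
    (hgb : ∀ U, |g U| ≤ Cg)
    (hgg : ∀ (k : Site 3 L → SU2) (U : GaugeConfig 3 L SU2), g (gaugeTransform k U) = g U)
    (hgz : ∀ (k : Fin 3), ∀ z ∈ Subgroup.center SU2, ∀ U : GaugeConfig 3 L SU2, g (twist k z U) = g U)
    {Ω : GaugeConfig 3 L SU2 → ℝ} (hΩ : IsPhys Ω) (heig : transferApply β Ω = topValue su2Rep L β • Ω) :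
    topValue su2Rep L β * l2 (fun U => g U * Ω U) (fun U => g U * Ω U) -
        qform su2Rep β (fun U => g U * Ω U) (fun U => g U * Ω U) =
      (1 / 2) * ∫ p, Ω p.1 * transferKernel su2Rep β p.1 p.2 * Ω p.2 * (g p.1 - g p.2) ^ 2
        ∂(configMeasure SU2 L).prod (configMeasure SU2 L) := by
  have h := energy_mul_eq_su2 (L := L) β hgm hgb hgg hgz hΩ (topValue su2Rep L β)
  rw [h, heig, l2_comm (fun U => g U ^ 2 * Ω U) (topValue su2Rep L β • Ω), l2_smul_left,
    l2_comm Ω (fun U => g U ^ 2 * Ω U)]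
  ring

/-! ## §2 The elementary Jensen step -/

omit [NeZero L] in
/-- **Tangent-line Jensen.**  On any measure space, for a non-negative weight `w` with `∫ w = T > 0`, a real `X` with `X·w` and `e^X·w`
integrable and `M = ∫ e^X w`: `∫ X w ≤ T · log (M/T)`.  (From `e^{X − a} ≥ 1 + X − a` at `a = log(M/T)`.) [folklore] -/
theorem integral_mul_le_mul_log {α : Type*} [MeasurableSpace α] (μ : Measure α) {w X : α → ℝ} (hw : ∀ a, 0 ≤ w a)
    {T : ℝ} (hT : 0 < T) (hwT : ∫ a, w a ∂μ = T) (hXw : Integrable (fun a => X a * w a) μ)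
    (heXw : Integrable (fun a => Real.exp (X a) * w a) μ) (hwi : Integrable w μ)
    {M : ℝ} (hM : ∫ a, Real.exp (X a) * w a ∂μ = M) (hMpos : 0 < M) :
    ∫ a, X a * w a ∂μ ≤ T * Real.log (M / T) := by
  set c : ℝ := Real.log (M / T) with hc
  have hMT : Real.exp c = M / T := by rw [hc, Real.exp_log (div_pos hMpos hT)]
  -- pointwise tangent line: `(M/T)(1 + X − c) w ≤ e^X w`
  have hpt : ∀ a, (M / T) * (1 + (X a - c)) * w a ≤ Real.exp (X a) * w a := by
    intro a
    refine mul_le_mul_of_nonneg_right ?_ (hw a)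
    rw [← hMT]
    have h1 : (X a - c) + 1 ≤ Real.exp (X a - c) := Real.add_one_le_exp _
    have h2 : Real.exp c * Real.exp (X a - c) = Real.exp (X a) := by rw [← Real.exp_add]; ring_nf
    calc Real.exp c * (1 + (X a - c)) ≤ Real.exp c * Real.exp (X a - c) :=
          mul_le_mul_of_nonneg_left (by linarith) (Real.exp_pos c).le
      _ = Real.exp (X a) := h2
  have hlin : Integrable (fun a => (M / T) * (1 + (X a - c)) * w a) μ := by
    have : (fun a => (M / T) * (1 + (X a - c)) * w a) = fun a => (M / T) * (1 - c) * w a + (M / T) * (X a * w a) := by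
      funext a; ring
    rw [this]
    exact (hwi.const_mul _).add (hXw.const_mul _)
  have hint := integral_mono hlin heXw hpt
  have hlhs : ∫ a, (M / T) * (1 + (X a - c)) * w a ∂μ = (M / T) * (1 - c) * T + (M / T) * ∫ a, X a * w a ∂μ := by
    have : (fun a => (M / T) * (1 + (X a - c)) * w a) = fun a => (M / T) * (1 - c) * w a + (M / T) * (X a * w a) := by
      funext a; ring
    rw [this, integral_add (hwi.const_mul _) (hXw.const_mul _), integral_const_mul, integral_const_mul, hwT]
  rw [hlhs, hM] at hint
  -- `(M/T)(1 − c)T + (M/T)∫Xw ≤ M` ⇒ `∫Xw ≤ T c`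
  have hMT0 : 0 < M / T := div_pos hMpos hT
  have h3 : (M / T) * ∫ a, X a * w a ∂μ ≤ (M / T) * (T * c) := by
    have : (M / T) * (1 - c) * T = M - (M / T) * (T * c) := by field_simp
    nlinarith [hint, this]
  exact le_of_mul_le_mul_left h3 hMT0

/-! ## §3 The mean temporal plaquette in the vacuum pair measure -/

/-- `timeCoupling ≤ 2|E|` (`Re tr W ≤ 2` on `SU(2)`). [folklore] -/
theorem timeCoupling_le_two_card (U V : GaugeConfig 3 L SU2) :
    timeCoupling su2Rep U V ≤ 2 * Fintype.card (Edge 3 L) := by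
  unfold timeCoupling
  calc ∑ e : Edge 3 L, ((su2Rep (U e * (V e)⁻¹)).trace).re ≤ ∑ _e : Edge 3 L, (2 : ℝ) :=
        Finset.sum_le_sum fun e _ => by rw [fundamentalRep_apply]; exact re_trace_le_two _
    _ = 2 * Fintype.card (Edge 3 L) := by rw [Finset.sum_const, Finset.card_univ, nsmul_eq_mul, mul_comm]

/-- `−2|E| ≤ timeCoupling` (`−2 ≤ Re tr W` on `SU(2)`). [folklore] -/
theorem neg_two_card_le_timeCoupling (U V : GaugeConfig 3 L SU2) :
    -(2 * (Fintype.card (Edge 3 L) : ℝ)) ≤ timeCoupling su2Rep U V := by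
  unfold timeCoupling
  calc -(2 * (Fintype.card (Edge 3 L) : ℝ)) = ∑ _e : Edge 3 L, (-2 : ℝ) := by
        rw [Finset.sum_const, Finset.card_univ, nsmul_eq_mul]; ring
    _ ≤ ∑ e : Edge 3 L, ((su2Rep (U e * (V e)⁻¹)).trace).re :=
        Finset.sum_le_sum fun e _ => by rw [fundamentalRep_apply]; exact neg_two_le_re_trace _

/-- The tilted kernel: `e^{(β/2)(2|E| − timeCoupling)} K_β(U,V) ≤ e^{β|E|} E_{β/2}(U,V)` (drop the magnetic Boltzmann factor `≤ 1`;
`β ≥ 0`). [folklore] -/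
theorem exp_tilt_mul_transferKernel_le {β : ℝ} (hβ : 0 ≤ β) (U V : GaugeConfig 3 L SU2) :
    Real.exp (β / 2 * (2 * Fintype.card (Edge 3 L) - timeCoupling su2Rep U V)) * transferKernel su2Rep β U V ≤
      Real.exp (β * Fintype.card (Edge 3 L)) * latE L (β / 2) U V := by
  rw [transferKernel_eq_latE_mul, latE_eq_exp, latE_eq_exp]
  have hS := add_nonneg (wilsonAction_su2_nonneg_lat U) (wilsonAction_su2_nonneg_lat V)
  have h1 : Real.exp (-(β / 2) * (wilsonAction su2Rep U + wilsonAction su2Rep V)) ≤ 1 :=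
    Real.exp_le_one_iff.mpr (by nlinarith)
  have h2 : Real.exp (β / 2 * (2 * Fintype.card (Edge 3 L) - timeCoupling su2Rep U V)) * Real.exp (β * timeCoupling su2Rep U V) =
      Real.exp (β * Fintype.card (Edge 3 L)) * Real.exp (β / 2 * timeCoupling su2Rep U V) := by
    rw [← Real.exp_add, ← Real.exp_add]; ring_nf
  calc Real.exp (β / 2 * (2 * Fintype.card (Edge 3 L) - timeCoupling su2Rep U V)) *
        (Real.exp (β * timeCoupling su2Rep U V) * Real.exp (-(β / 2) * (wilsonAction su2Rep U + wilsonAction su2Rep V)))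
      = (Real.exp (β * Fintype.card (Edge 3 L)) * Real.exp (β / 2 * timeCoupling su2Rep U V)) *
          Real.exp (-(β / 2) * (wilsonAction su2Rep U + wilsonAction su2Rep V)) := by rw [← mul_assoc, h2]
    _ ≤ (Real.exp (β * Fintype.card (Edge 3 L)) * Real.exp (β / 2 * timeCoupling su2Rep U V)) * 1 :=
          mul_le_mul_of_nonneg_left h1 (by positivity)
    _ = Real.exp (β * Fintype.card (Edge 3 L)) * Real.exp (β / 2 * timeCoupling su2Rep U V) := mul_one _

/-- The log-ratio budget `Γ(β, L) = (8|P| + 2|E|) + 2|E| log(5⁸(8β+1)¹⁹) + |E| (log(4β²) − log w₀)`, `w₀ = e^{−1/2}·8/(3π³)`: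
`log(e^{β|E|} c_{β/2}^{|E|} / λ₀(β)) ≤ Γ` for `β ≥ 1` — the `β|E|` terms cancel. [cite: Luscher1983, §2] -/
theorem log_tilt_ratio_le {β : ℝ} (hβ : 1 ≤ β) :
    Real.log (Real.exp (β * Fintype.card (Edge 3 L)) * latCE L (β / 2) / topValue su2Rep L β) ≤
      (8 * (Fintype.card (Plaquette 3 L) : ℝ) + 2 * Fintype.card (Edge 3 L)) +
        2 * Fintype.card (Edge 3 L) * Real.log ((5 : ℝ) ^ 8 * (8 * β + 1) ^ 19) +
        Fintype.card (Edge 3 L) * (Real.log (4 * β ^ 2) - Real.log (Real.exp (-(1 / 2 : ℝ)) * (8 / (3 * π ^ 3)))) := by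
  have hβ0 : 0 < β := by linarith
  set E : ℕ := Fintype.card (Edge 3 L) with hE
  set P : ℕ := Fintype.card (Plaquette 3 L) with hP
  set w₀ : ℝ := Real.exp (-(1 / 2 : ℝ)) * (8 / (3 * π ^ 3)) with hw₀
  have hw₀pos : 0 < w₀ := by positivity
  set q : ℝ := ((5 : ℝ) ^ 8 * (8 * β + 1) ^ 19) with hq
  have hqpos : 0 < q := by positivity
  have hT := topValue_su2Rep_pos L β
  -- lower bound on `λ₀`
  have hfloor : Real.exp (-(8 * (P : ℝ) + 2 * E)) * (q⁻¹) ^ (2 * E) * latCE L β ≤ topValue su2Rep L β := by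
    have h := levelValue_zero_ge_poly (L := L) hβ
    rw [levelValue_zero] at h
    exact h
  -- `c_β ≥ e^{2β} w₀/(4β²)` and `c_{β/2} ≤ e^{β}`
  have hcβ : Real.exp (2 * β) * (w₀ / (4 * β ^ 2)) ≤ linkC β := linkC_ge_poly hβ
  have hcβ0 : 0 < Real.exp (2 * β) * (w₀ / (4 * β ^ 2)) := by positivity
  have hchalf : linkC (β / 2) ≤ Real.exp β := by
    have h := linkC_le (show (0 : ℝ) ≤ β / 2 by positivity)
    have : 2 * (β / 2) = β := by ring
    rwa [this] at h
  have hchalf0 : 0 < linkC (β / 2) := linkC_pos (by positivity)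
  -- assemble in logs
  have hnum0 : 0 < Real.exp (β * E) * latCE L (β / 2) := mul_pos (Real.exp_pos _) (latCE_pos (by positivity))
  rw [Real.log_div hnum0.ne' hT.ne', Real.log_mul (Real.exp_pos _).ne' (latCE_pos (by positivity)).ne', Real.log_exp]
  -- `log latCE(β/2) ≤ E β`
  have h1 : Real.log (latCE L (β / 2)) ≤ E * β := by
    unfold latCE
    rw [← hE, Real.log_pow]
    exact mul_le_mul_of_nonneg_left ((Real.log_le_log_iff hchalf0 (Real.exp_pos _)).2 hchalf |>.trans (Real.log_exp β).le)
      (Nat.cast_nonneg _)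
  -- `log λ₀ ≥ −(8P+2E) − 2E log q + E (2β + log(w₀/(4β²)))`
  have h2 : -(8 * (P : ℝ) + 2 * E) - 2 * E * Real.log q + E * (2 * β + (Real.log w₀ - Real.log (4 * β ^ 2))) ≤
      Real.log (topValue su2Rep L β) := by
    have hlat : E * (2 * β + (Real.log w₀ - Real.log (4 * β ^ 2))) ≤ Real.log (latCE L β) := by
      unfold latCE
      rw [← hE, Real.log_pow]
      refine mul_le_mul_of_nonneg_left ?_ (Nat.cast_nonneg _)
      have h := (Real.log_le_log_iff hcβ0 (linkC_pos hβ0.le)).2 hcβ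
      rw [Real.log_mul (Real.exp_pos _).ne' (by positivity), Real.log_exp, Real.log_div hw₀pos.ne' (by positivity)] at h
      exact h
    have hprod0 : 0 < Real.exp (-(8 * (P : ℝ) + 2 * E)) * (q⁻¹) ^ (2 * E) * latCE L β := by
      have := latCE_pos (L := L) hβ0.le; positivity
    have h := (Real.log_le_log_iff hprod0 hT).2 hfloor
    rw [Real.log_mul (by positivity) (latCE_pos hβ0.le).ne', Real.log_mul (Real.exp_pos _).ne' (by positivity), Real.log_exp,
      Real.log_pow, Real.log_inv] at h
    push_cast at h
    linarith
  linarith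

/-- ★★ **Mean temporal plaquette in the vacuum pair measure.**  `β ≥ 1`; `Ω ≥ 0` physical, `‖Ω‖ = 1`, `K_βΩ = λ₀Ω`.  Then
`∫∫ Ω(U) K_β(U,V) Ω(V) · (2|E| − timeCoupling(U,V)) dU dV ≤ (2/β) · λ₀ · Γ(β, L)` with the explicit `Γ = O(|E| log β)` of
`log_tilt_ratio_le` — i.e. the mean of `Σₑ(1 − ½ Re tr UₑVₑ⁻¹)` in the vacuum pair PROBABILITY measure is `O(|E| log β / β)`.
Jensen (`integral_mul_le_mul_log`) + `exp_tilt_mul_transferKernel_le` + row sums of `E_{β/2}` + the free-energy bounds.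
[cite: Luscher1983, §2] [cite: ReedSimonIV1978, Thm. XIII.1] -/
theorem vacuum_mean_temporal_plaquette_le {β : ℝ} (hβ : 1 ≤ β) {Ω : GaugeConfig 3 L SU2 → ℝ} (hΩ : IsPhys Ω)
    (hΩnn : ∀ U, 0 ≤ Ω U) (hn : l2 Ω Ω = 1) (heig : transferApply β Ω = topValue su2Rep L β • Ω) :
    ∫ p, Ω p.1 * transferKernel su2Rep β p.1 p.2 * Ω p.2 * (2 * Fintype.card (Edge 3 L) - timeCoupling su2Rep p.1 p.2)
        ∂(configMeasure SU2 L).prod (configMeasure SU2 L) ≤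
      (2 / β) * topValue su2Rep L β *
        ((8 * (Fintype.card (Plaquette 3 L) : ℝ) + 2 * Fintype.card (Edge 3 L)) +
          2 * Fintype.card (Edge 3 L) * Real.log ((5 : ℝ) ^ 8 * (8 * β + 1) ^ 19) +
          Fintype.card (Edge 3 L) * (Real.log (4 * β ^ 2) - Real.log (Real.exp (-(1 / 2 : ℝ)) * (8 / (3 * π ^ 3))))) := by
  haveI : SecondCountableTopology SU2 := secondCountableTopology_su2
  have hβ0 : 0 < β := by linarith
  set μ2 : Measure (GaugeConfig 3 L SU2 × GaugeConfig 3 L SU2) := (configMeasure SU2 L).prod (configMeasure SU2 L) with hμ2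
  set E : ℕ := Fintype.card (Edge 3 L) with hE
  set T : ℝ := topValue su2Rep L β with hT_def
  have hT : 0 < T := topValue_su2Rep_pos L β
  obtain ⟨CΩ, hCΩ⟩ := hΩ.bounded
  have hCΩ0 : 0 ≤ CΩ := (abs_nonneg _).trans (hCΩ (fun _ => 1))
  -- the weight `w = Ω K Ω ≥ 0` and the tilt `X = (β/2)(2E − tc) ∈ [0, 2βE]`
  set w : GaugeConfig 3 L SU2 × GaugeConfig 3 L SU2 → ℝ := fun p => Ω p.1 * transferKernel su2Rep β p.1 p.2 * Ω p.2 with hw_def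
  set X : GaugeConfig 3 L SU2 × GaugeConfig 3 L SU2 → ℝ := fun p => β / 2 * (2 * E - timeCoupling su2Rep p.1 p.2) with hX_def
  have hw0 : ∀ p, 0 ≤ w p := fun p =>
    mul_nonneg (mul_nonneg (hΩnn _) (transferKernel_pos _ _ _ _).le) (hΩnn _)
  have hX0 : ∀ p, 0 ≤ X p := fun p => by
    have := timeCoupling_le_two_card (L := L) p.1 p.2
    rw [hX_def]; dsimp only; rw [← hE] at this; exact mul_nonneg (by positivity) (by linarith)
  have hXle : ∀ p, X p ≤ 2 * β * E := fun p => by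
    have := neg_two_card_le_timeCoupling (L := L) p.1 p.2
    rw [hX_def]; dsimp only; rw [← hE] at this; nlinarith
  -- measurability
  have hKm : Measurable fun p : GaugeConfig 3 L SU2 × GaugeConfig 3 L SU2 => transferKernel su2Rep β p.1 p.2 :=
    measurable_transferKernel_lat β
  have htcm : Measurable fun p : GaugeConfig 3 L SU2 × GaugeConfig 3 L SU2 => timeCoupling su2Rep p.1 p.2 :=
    (continuous_timeCoupling su2Rep continuous_su2Rep).measurable
  have hwm : Measurable w := ((hΩ.measurable.comp measurable_fst).mul hKm).mul (hΩ.measurable.comp measurable_snd)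
  have hXm : Measurable X := measurable_const.mul (measurable_const.sub htcm)
  have hKb : ∀ p : GaugeConfig 3 L SU2 × GaugeConfig 3 L SU2, |transferKernel su2Rep β p.1 p.2| ≤ Real.exp (2 * β) ^ E :=
    fun p => abs_transferKernel_le_lat hβ0.le p
  have hwb : ∀ p, |w p| ≤ CΩ * Real.exp (2 * β) ^ E * CΩ := fun p => by
    rw [hw_def]; dsimp only; rw [abs_mul, abs_mul]
    exact mul_le_mul (mul_le_mul (hCΩ _) (hKb p) (abs_nonneg _) hCΩ0) (hCΩ _) (abs_nonneg _) (by positivity)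
  have hXb : ∀ p, |X p| ≤ 2 * β * E := fun p => by rw [abs_of_nonneg (hX0 p)]; exact hXle p
  have hwi : Integrable w μ2 := integrable_latProd hwm hwb
  have hXwi : Integrable (fun p => X p * w p) μ2 :=
    integrable_latProd (hXm.mul hwm) (C := 2 * β * E * (CΩ * Real.exp (2 * β) ^ E * CΩ)) fun p => by
      rw [abs_mul]; exact mul_le_mul (hXb p) (hwb p) (abs_nonneg _) (by positivity)
  have heXwi : Integrable (fun p => Real.exp (X p) * w p) μ2 :=
    integrable_latProd ((Real.measurable_exp.comp hXm).mul hwm)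
      (C := Real.exp (2 * β * E) * (CΩ * Real.exp (2 * β) ^ E * CΩ)) fun p => by
      rw [abs_mul, abs_of_pos (Real.exp_pos _)]
      exact mul_le_mul (Real.exp_le_exp.2 (hXle p)) (hwb p) (abs_nonneg _) (Real.exp_pos _).le
  -- total mass `∫ w = λ₀`
  have hwT : ∫ p, w p ∂μ2 = T := by
    rw [hw_def, hμ2, ← qform_eq_integral_latProd hβ0.le hΩ, qform_eq_l2_transferApply, heig, l2_comm, l2_smul_left, hn, mul_one]
  -- the tilted mass `M ≤ e^{βE} c_{β/2}^E`
  set M : ℝ := ∫ p, Real.exp (X p) * w p ∂μ2 with hM_def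
  have hMle : M ≤ Real.exp (β * E) * latCE L (β / 2) := by
    have hpt : ∀ p, Real.exp (X p) * w p ≤
        Real.exp (β * E) * (latE L (β / 2) p.1 p.2 * (Ω p.1 ^ 2) / 2 + latE L (β / 2) p.1 p.2 * (Ω p.2 ^ 2) / 2) := by
      intro p
      have h1 := exp_tilt_mul_transferKernel_le (L := L) hβ0.le p.1 p.2
      rw [← hE] at h1
      have h2 : Real.exp (X p) * w p = (Real.exp (X p) * transferKernel su2Rep β p.1 p.2) * (Ω p.1 * Ω p.2) := by
        rw [hw_def]; ring
      rw [h2]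
      have hΩΩ : 0 ≤ Ω p.1 * Ω p.2 := mul_nonneg (hΩnn _) (hΩnn _)
      have hamgm : Ω p.1 * Ω p.2 ≤ (Ω p.1 ^ 2 + Ω p.2 ^ 2) / 2 := by nlinarith [sq_nonneg (Ω p.1 - Ω p.2)]
      have hE0 : 0 ≤ Real.exp (β * ↑E) * latE L (β / 2) p.1 p.2 := mul_nonneg (Real.exp_pos _).le (latE_pos _ _ _).le
      calc Real.exp (X p) * transferKernel su2Rep β p.1 p.2 * (Ω p.1 * Ω p.2)
          ≤ Real.exp (β * E) * latE L (β / 2) p.1 p.2 * (Ω p.1 * Ω p.2) := mul_le_mul_of_nonneg_right h1 hΩΩ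
        _ ≤ Real.exp (β * E) * latE L (β / 2) p.1 p.2 * ((Ω p.1 ^ 2 + Ω p.2 ^ 2) / 2) := mul_le_mul_of_nonneg_left hamgm hE0
        _ = Real.exp (β * E) * (latE L (β / 2) p.1 p.2 * (Ω p.1 ^ 2) / 2 + latE L (β / 2) p.1 p.2 * (Ω p.2 ^ 2) / 2) := by ring
    have hfst := integral_prod_latE_mul_fst (L := L) (β / 2) (hΩ.measurable.pow_const 2) (C := CΩ * CΩ)
      (fun U => by rw [abs_pow, sq]; exact mul_le_mul (hCΩ U) (hCΩ U) (abs_nonneg _) hCΩ0) (by positivity)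
    have hsnd := integral_prod_latE_mul_snd (L := L) (β / 2) (hΩ.measurable.pow_const 2) (C := CΩ * CΩ)
      (fun U => by rw [abs_pow, sq]; exact mul_le_mul (hCΩ U) (hCΩ U) (abs_nonneg _) hCΩ0) (by positivity)
    have hΩ2int : ∫ U, Ω U ^ 2 ∂configMeasure SU2 L = 1 := by
      rw [← hn]; unfold l2; exact integral_congr_ae (ae_of_all _ fun U => by ring)
    have hi1 : Integrable (fun p : GaugeConfig 3 L SU2 × GaugeConfig 3 L SU2 => latE L (β / 2) p.1 p.2 * Ω p.1 ^ 2) μ2 :=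
      integrable_latProd ((measurable_latE (β / 2)).mul ((hΩ.measurable.pow_const 2).comp measurable_fst))
        (C := Real.exp (2 * (β / 2)) ^ E * (CΩ * CΩ)) fun p => by
        rw [abs_mul]
        exact mul_le_mul (abs_latE_le (by positivity) _ _)
          (by rw [abs_pow, sq]; exact mul_le_mul (hCΩ _) (hCΩ _) (abs_nonneg _) hCΩ0) (abs_nonneg _) (by positivity)
    have hi2 : Integrable (fun p : GaugeConfig 3 L SU2 × GaugeConfig 3 L SU2 => latE L (β / 2) p.1 p.2 * Ω p.2 ^ 2) μ2 :=
      integrable_latProd ((measurable_latE (β / 2)).mul ((hΩ.measurable.pow_const 2).comp measurable_snd))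
        (C := Real.exp (2 * (β / 2)) ^ E * (CΩ * CΩ)) fun p => by
        rw [abs_mul]
        exact mul_le_mul (abs_latE_le (by positivity) _ _)
          (by rw [abs_pow, sq]; exact mul_le_mul (hCΩ _) (hCΩ _) (abs_nonneg _) hCΩ0) (abs_nonneg _) (by positivity)
    have hrhs_int : Integrable (fun p : GaugeConfig 3 L SU2 × GaugeConfig 3 L SU2 =>
        Real.exp (β * E) * (latE L (β / 2) p.1 p.2 * (Ω p.1 ^ 2) / 2 + latE L (β / 2) p.1 p.2 * (Ω p.2 ^ 2) / 2)) μ2 :=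
      ((hi1.div_const 2).add (hi2.div_const 2)).const_mul _
    have hmono := integral_mono heXwi hrhs_int hpt
    have hrhs : ∫ p, Real.exp (β * E) * (latE L (β / 2) p.1 p.2 * (Ω p.1 ^ 2) / 2 + latE L (β / 2) p.1 p.2 * (Ω p.2 ^ 2) / 2) ∂μ2 =
        Real.exp (β * E) * latCE L (β / 2) := by
      rw [integral_const_mul, integral_add (hi1.div_const 2) (hi2.div_const 2), integral_div, integral_div, hμ2, hfst, hsnd, hΩ2int]
      ring
    rw [hrhs] at hmono
    exact hmono
  have hMpos : 0 < M := by
    have hge : ∫ p, w p ∂μ2 ≤ M := integral_mono hwi heXwi fun p => by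
      have : 1 ≤ Real.exp (X p) := Real.one_le_exp (hX0 p)
      nlinarith [hw0 p]
    linarith
  -- Jensen
  have hJ := integral_mul_le_mul_log μ2 hw0 hT hwT hXwi heXwi hwi rfl hMpos
  have hlog : Real.log (M / T) ≤
      (8 * (Fintype.card (Plaquette 3 L) : ℝ) + 2 * E) + 2 * E * Real.log ((5 : ℝ) ^ 8 * (8 * β + 1) ^ 19) +
        E * (Real.log (4 * β ^ 2) - Real.log (Real.exp (-(1 / 2 : ℝ)) * (8 / (3 * π ^ 3)))) := by
    have h1 : Real.log (M / T) ≤ Real.log (Real.exp (β * E) * latCE L (β / 2) / T) :=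
      Real.log_le_log (div_pos hMpos hT) (div_le_div_of_nonneg_right hMle hT.le)
    exact h1.trans (by have := log_tilt_ratio_le (L := L) hβ; rw [← hE] at this; exact this)
  -- conclude: `∫ w (2E − tc) = (2/β) ∫ X w`
  have hconv : (fun p : GaugeConfig 3 L SU2 × GaugeConfig 3 L SU2 =>
      Ω p.1 * transferKernel su2Rep β p.1 p.2 * Ω p.2 * (2 * E - timeCoupling su2Rep p.1 p.2)) =
      fun p => (2 / β) * (X p * w p) := by
    funext p
    rw [hX_def, hw_def]; dsimp only
    field_simp
  rw [hconv, integral_const_mul]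
  have h2β : 0 ≤ 2 / β := by positivity
  calc 2 / β * ∫ p, X p * w p ∂μ2 ≤ 2 / β * (T * Real.log (M / T)) := mul_le_mul_of_nonneg_left hJ h2β
    _ ≤ 2 / β * (T * ((8 * (Fintype.card (Plaquette 3 L) : ℝ) + 2 * E) + 2 * E * Real.log ((5 : ℝ) ^ 8 * (8 * β + 1) ^ 19) +
        E * (Real.log (4 * β ^ 2) - Real.log (Real.exp (-(1 / 2 : ℝ)) * (8 / (3 * π ^ 3)))))) :=
        mul_le_mul_of_nonneg_left (mul_le_mul_of_nonneg_left hlog hT.le) h2β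
    _ = _ := by ring

end Summit.QuantumFields.YangMills.Theorems.AdjointLoopFano

end
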